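import Literature.AlgebraicGeometry.Resolution.WeightedCentreRZReduction
import Literature.AlgebraicGeometry.Resolution.WeightedCentreRZFirstOrder
import Literature.AlgebraicGeometry.Resolution.WeightedCentreRZUnpin
import Literature.AlgebraicGeometry.Resolution.WeightedCentreRZEndgame
import Literature.AlgebraicGeometry.Resolution.WeightedCentreRZTransport
import Literature.AlgebraicGeometry.Resolution.WeightedCentreRZToolkit
import HarnessLib

/-!
# THEOREM RZ assembled: a rigid, pinned fixing shift of `σ`-degree `≤ p` is trivial
# (instrument for engine 1's `W(f)` toy model, NOT a resolution theorem)

Engine 1 of the RESOLUTION OBSERVATORY toy model `W(f)` (cell notes RE-DERIVATION-eng1-g41 §3.7.4 THEOREM RZ "(`p` odd, `k` perfect;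
RIGID + the pins).  `X = id`"; CARVER-NOTES-eng1-g42 T92, verdict GO).  This file COMPOSES the cell's instruments into the engine's
THEOREM RZ in the additive bookkeeping of `WeightedCentreAdditiveShifts`:

`TheoremRZ.eq_zero` — DATA: a prime `p = char k`, `k` perfect; a fixing shift `P ∈ AdditiveShift.fixingShifts U G`
(`G(ε + P(σ, ε_U)) = G(ε)`, `P = 0` on `U`) of `σ`-degree `≤ p` without constant terms; a pointwise-fixed INITIAL SEGMENT `Z ⊆ U` of slots (any number
of weight classes, of any weights — CARVER-NOTES-eng1-g43 §1 (a) — lighter than every slot outside `Z`) such that all blocks `[σ^s]P_x` are `Z`-forms (RIGID) of the twisted weights `w_x - sρ₁` (LEMMA S);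
`G` weighted homogeneous of weight `μ`; the slots carrying an order-`p` block are `f`-slots (`p·w_x = μ`) or `I`-slots
(`p·w_x < μ < (p+1)·w_x`); the weight inequality `(★) w_{x'} - pρ₁ < p·(w_x - ρ₁)` between slots carrying order-`1` and order-`p` blocks;
and the pins `(P)_{C_x}` of `killLight (w_x ≤ w) G` at every moved slot `x`.  CONCLUSION: `P = 0`.

PROOF (the engine's, step by step): `RZReduction.shape_of_ne_zero` (`P = σP₁ + σ^pP_p`, `P_p ≠ 0`; LEMMAS G/C/L) →
`RZFirstOrder.coeff_sum_leading_mul_pderiv_eq_zero` (`(E_p)`: `Σ_j P^{lead}_{p,j}(ε_Z) ∂_j Ḡ = 0`, hence `∂_{θ_γ} Ḡ = 0` for every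
coefficient vector `θ_γ`, `RZUnpin.dirDeriv_weightedHomogeneousComponent_zero_eq_zero`) → the directions split by weight class
(`RZToolkit.dirDeriv_restrict_eq_zero`), so `∂_θ F = 0` for `F := killLight_{C*} Ḡ = killLight_{C*} G` and a nonzero `θ` on the class `C*`
of a slot where the minimal `Z`-degree `d*` is attained → case `C*` an `I`-class: `RZUnpin.not_classPinned_of_dirDeriv_eq_zero` contradicts
the pin; case `C* = f`: `RZUnpin.exists_rank_one_of_forall_dirDeriv_eq_zero` (`P_p = θ ⊗ α`), the change of basis `e_{j₀} := θ`
(`WeightedCentreRZTransport`, `InvariantDirection.exists_classLinear_col_eq`), the pin coefficient `c ≠ 0` of `X_{j₀}^p`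
(`RZToolkit.coeff_single_ne_zero_of_pderiv_eq_zero`) and `RZEndgame.eq_zero_of_isotropy` (`(E_{p²})`: `c α^p = 0`) give `α = 0`,
contradiction.

What is NOT here: the derivation of the hypotheses from the engine's menus `W^{maj}` (the weight inequalities `(H_w)`, `(★)`, the
`f`/`I` dichotomy for order-`p` blocks, LEMMA S) — they are hypotheses of the theorem, discharged menu by menu by engine 1.

References: [Lang2002, Ch. IV §1, Ch. V §6, Ch. XIII §4]; [SerreLocalFields1979, Ch. II §4 Lemma 1] (the additive bookkeeping of
isotropies); the weighted frame [AbramovichTemkinWlodarczyk2024, §5.1 (p. 1575), Thm. 5.3.1].  The statement is OURS (toy-model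
bookkeeping; AI-written Lean, AI review is weaker than expert review) — NOT a statement about the invariant of
[AbramovichTemkinWlodarczyk2024], NOT progress on the summit.
-/

namespace Literature.AlgebraicGeometry.Resolution.WeightedBlowup

namespace TheoremRZ

open MvPolynomial

variable {k : Type*} [Field k] {ι : Type*} [Fintype ι] [DecidableEq ι]

omit [Fintype ι] [DecidableEq ι] in
/-- An `ℕ`-valued rescaling `zw = N·w` on `Z` (`0` off `Z`) of positive rational weights exists (bookkeeping: the `Z`-weight of THEOREM RZ must be
`ℕ`-valued for the graded instruments). [cite: AbramovichTemkinWlodarczyk2024, §5.1 (p. 1575)] -/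
theorem exists_scaling (w : ι → ℚ) (hw : ∀ i, 0 < w i) (Z : Finset ι) :
    ∃ (N : ℚ) (zw : ι → ℕ), 0 < N ∧ (∀ i ∈ Z, (zw i : ℚ) = N * w i) ∧ ∀ i, i ∉ Z → zw i = 0 := by
  classical
  refine ⟨((∏ j ∈ Z, (w j).den : ℕ) : ℚ), fun i => if i ∈ Z then (∏ j ∈ Z, (w j).den) / (w i).den * (w i).num.toNat else 0,
    by exact_mod_cast Finset.prod_pos fun j _ => (w j).den_pos, fun i hi => ?_, fun i hi => if_neg hi⟩
  have hdvd : (w i).den ∣ ∏ j ∈ Z, (w j).den := Finset.dvd_prod_of_mem (fun j => (w j).den) hi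
  obtain ⟨c, hc⟩ := hdvd
  dsimp only
  rw [if_pos hi, hc, Nat.mul_div_cancel_left c (w i).den_pos]
  have hnum : 0 < (w i).num := Rat.num_pos.mpr (hw i)
  have h1 : (((w i).num.toNat : ℕ) : ℤ) = (w i).num := Int.toNat_of_nonneg hnum.le
  have h1' : (((w i).num.toNat : ℕ) : ℚ) = ((w i).num : ℚ) := by exact_mod_cast h1
  have h2 : ((w i).den : ℚ) * w i = (w i).num := by
    rw [mul_comm]
    exact Rat.mul_den_eq_num (w i)
  push_cast
  rw [h1', mul_comm ((w i).den : ℚ) (c : ℚ), mul_assoc, h2]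

omit [Fintype ι] [DecidableEq ι] in
/-- With such a rescaling, the `Z`-weight of a monomial in `Z`-variables is `N` times its weight (bookkeeping; "the `Z′`-weight of the block
`P_{p,x}` is `w_x - pρ₁`"). [cite: AbramovichTemkinWlodarczyk2024, §5.1 (p. 1575)] -/
theorem weight_eq_mul_of_forall_mem {Z : Finset ι} {w : ι → ℚ} {N : ℚ} {zw : ι → ℕ} (hzwZ : ∀ i ∈ Z, (zw i : ℚ) = N * w i)
    {m : ι →₀ ℕ} (hm : ∀ i ∈ m.support, i ∈ Z) : (Finsupp.weight zw m : ℚ) = N * Finsupp.weight w m := by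
  rw [Finsupp.weight_apply, Finsupp.weight_apply, Finsupp.sum, Finsupp.sum, Nat.cast_sum, Finset.mul_sum]
  refine Finset.sum_congr rfl fun i hi => ?_
  rw [smul_eq_mul, Nat.cast_mul, hzwZ i (hm i hi), nsmul_eq_mul]
  ring

/-- **THEOREM RZ** of engine 1's `W(f)` toy model, assembled (ours, bookkeeping): see the module docstring for the data, the conclusion
`P = 0` and the proof. [cite: AbramovichTemkinWlodarczyk2024, §5.1 (p. 1575), Thm. 5.3.1] -/
theorem eq_zero (p : ℕ) [Fact p.Prime] [CharP k p] (hperf : ∀ a : k, ∃ b : k, b ^ p = a)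
    {U : Set ι} {G : MvPolynomial ι k} {P : ι → Polynomial (MvPolynomial ι k)} (hPG : P ∈ AdditiveShift.fixingShifts U G)
    (hdeg : ∀ x, (P x).natDegree ≤ p) (h0 : ∀ x, (P x).coeff 0 = 0)
    (Z : Finset ι) (hZU : ∀ i ∈ Z, i ∈ U) (w : ι → ℚ) (hw : ∀ i, 0 < w i) (ρ₁ μ : ℚ)
    (hZlt : ∀ i ∈ Z, ∀ x, x ∉ Z → w i < w x) (hrigid : ∀ x s, ∀ i ∈ ((P x).coeff s).vars, i ∈ Z)
    (hTW : ∀ x, IsTW w ρ₁ (w x) (P x)) (hG : IsWeightedHomogeneous w G μ)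
    (hclass : ∀ x, (P x).coeff p ≠ 0 → (p : ℚ) * w x = μ ∨ ((p : ℚ) * w x < μ ∧ μ < (p + 1 : ℚ) * w x))
    (hstar : ∀ x x', (P x).coeff 1 ≠ 0 → (P x').coeff p ≠ 0 → w x' - p • ρ₁ < (p : ℚ) * (w x - 1 • ρ₁))
    (hPin : ∀ x, P x ≠ 0 →
      InvariantDirection.ClassPinned (Finset.univ.filter fun i => w i = w x) (killLight (fun i => w x ≤ w i) G) x) :
    P = 0 := by
  classical
  have hp0 : p ≠ 0 := (Fact.out : p.Prime).ne_zero
  have hp_pos : 0 < p := (Fact.out : p.Prime).pos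
  by_contra hP
  obtain ⟨⟨x₀, hx₀⟩, hshape⟩ :=
    RZReduction.shape_of_ne_zero p hPG hdeg h0 Z hZU w hw ρ₁ hZlt hrigid hTW hPin hP
  have hPG' := AdditiveShift.mem_fixingShifts_iff.mp hPG
  -- a slot carrying a nonzero block is moved, hence not in `Z`
  have hmovedZ : ∀ x s, (P x).coeff s ≠ 0 → x ∉ Z := fun x s hs hxZ => hs (by rw [hPG'.1 x (hZU x hxZ), Polynomial.coeff_zero])
  -- the `Z`-weight
  obtain ⟨N, zw, hN, hzwZ, hzw0⟩ := exists_scaling w hw Z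
  have hzwpos : ∀ i, 0 < zw i ↔ i ∈ Z := fun i => by
    constructor
    · intro h
      by_contra hi
      rw [hzw0 i hi] at h
      exact lt_irrefl 0 h
    · intro hi
      have h : (0 : ℚ) < zw i := by
        rw [hzwZ i hi]
        exact mul_pos hN (hw i)
      exact_mod_cast h
  -- `Z`-degrees of block monomials versus weights
  have hzdeg : ∀ x s, ∀ m ∈ ((P x).coeff s).support, (Finsupp.weight zw m : ℚ) = N * (w x - s • ρ₁) := by
    intro x s m hm
    rw [← hTW x s (mem_support_iff.mp hm)]
    exact weight_eq_mul_of_forall_mem hzwZ fun i hi => hrigid x s i ((mem_vars_iff_mem_support i).mpr ⟨m, hm, hi⟩)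
  -- the two columns
  obtain ⟨v, hv0d, hv1d⟩ : ∃ v : Fin 2 → ι → MvPolynomial ι k, (∀ j, v 0 j = (P j).coeff 1) ∧ ∀ j, v 1 j = (P j).coeff p :=
    ⟨fun t j => if t = 0 then (P j).coeff 1 else (P j).coeff p, fun _ => if_pos rfl, fun _ => if_neg (by decide)⟩
  -- `d*`: the least `Z`-degree of a monomial of `P_p`, attained at `(j₀, γ₀)`
  obtain ⟨dstar, j₀, γ₀, hγ₀, hγ₀w, hdstar⟩ : ∃ (dstar : ℕ) (j₀ : ι) (γ₀ : ι →₀ ℕ), γ₀ ∈ ((P j₀).coeff p).support ∧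
      Finsupp.weight zw γ₀ = dstar ∧ ∀ x, ∀ m ∈ ((P x).coeff p).support, dstar ≤ Finsupp.weight zw m := by
    let T : Finset (ι →₀ ℕ) := Finset.univ.biUnion fun x => ((P x).coeff p).support
    have hT : (T.image (Finsupp.weight zw)).Nonempty := by
      obtain ⟨m, hm⟩ := MvPolynomial.ne_zero_iff.mp hx₀
      exact ⟨_, Finset.mem_image_of_mem _ (Finset.mem_biUnion.mpr ⟨x₀, Finset.mem_univ _, mem_support_iff.mpr hm⟩)⟩
    obtain ⟨γ₀, hγ₀T, hγ₀w⟩ := Finset.mem_image.mp (Finset.min'_mem _ hT)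
    obtain ⟨j₀, -, hγ₀⟩ := Finset.mem_biUnion.mp hγ₀T
    exact ⟨(T.image (Finsupp.weight zw)).min' hT, j₀, γ₀, hγ₀, hγ₀w, fun x m hm => Finset.min'_le _ (Finsupp.weight zw m)
      (Finset.mem_image_of_mem (Finsupp.weight zw) (Finset.mem_biUnion.mpr ⟨x, Finset.mem_univ _, hm⟩))⟩
  -- `d₁`: the least `Z`-degree of a monomial of `P₁` (or anything, if `P₁ = 0`), with `(★) d* < p d₁`
  obtain ⟨d₁, hd₁, hstarN⟩ : ∃ d₁ : ℕ, (∀ x, ∀ m ∈ ((P x).coeff 1).support, d₁ ≤ Finsupp.weight zw m) ∧ dstar < p * d₁ := by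
    let T₁ : Finset (ι →₀ ℕ) := Finset.univ.biUnion fun x => ((P x).coeff 1).support
    by_cases hT₁ : (T₁.image (Finsupp.weight zw)).Nonempty
    · obtain ⟨m₁, hm₁T, hm₁w⟩ := Finset.mem_image.mp (Finset.min'_mem _ hT₁)
      obtain ⟨x₁, -, hm₁⟩ := Finset.mem_biUnion.mp hm₁T
      refine ⟨(T₁.image (Finsupp.weight zw)).min' hT₁, fun x m hm => Finset.min'_le _ (Finsupp.weight zw m)
        (Finset.mem_image_of_mem (Finsupp.weight zw) (Finset.mem_biUnion.mpr ⟨x, Finset.mem_univ _, hm⟩)), ?_⟩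
      rw [← hm₁w]
      have hlt := hstar x₁ j₀ (MvPolynomial.ne_zero_iff.mpr ⟨m₁, mem_support_iff.mp hm₁⟩)
        (MvPolynomial.ne_zero_iff.mpr ⟨γ₀, mem_support_iff.mp hγ₀⟩)
      have h : (Finsupp.weight zw γ₀ : ℚ) < p * (Finsupp.weight zw m₁ : ℚ) := by
        rw [hzdeg j₀ p γ₀ hγ₀, hzdeg x₁ 1 m₁ hm₁]
        have h' := mul_lt_mul_of_pos_left hlt hN
        linarith
      rw [hγ₀w] at h
      exact_mod_cast h
    · refine ⟨dstar + 1, fun x m hm => absurd ⟨_, Finset.mem_image_of_mem (Finsupp.weight zw)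
        (Finset.mem_biUnion.mpr ⟨x, Finset.mem_univ _, hm⟩)⟩ hT₁, ?_⟩
      calc dstar < dstar + 1 := Nat.lt_succ_self _
        _ ≤ p * (dstar + 1) := Nat.le_mul_of_pos_left _ hp_pos
  -- the monomial-curve data
  have hC : ∀ a : k, AdditiveShift.shiftHom P (Polynomial.C (C a)) = Polynomial.C (C a) := AdditiveShift.shiftHom_C_C P
  have hX : ∀ j, AdditiveShift.shiftHom P (Polynomial.C (X j))
      = Polynomial.C (X j) + ∑ t, Polynomial.X ^ (![1, p] : Fin 2 → ℕ) t * Polynomial.C (v t j) := by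
    intro j
    rw [AdditiveShift.shiftHom_C_X, hshape j, Fin.sum_univ_two, hv0d, hv1d]
    simp only [Matrix.cons_val_zero, Matrix.cons_val_one, pow_one]
    ring
  have hΦ : AdditiveShift.shiftHom P (Polynomial.C G) = Polynomial.C G := hPG'.2.2
  have hv0 : ∀ j, ∀ m ∈ (v 0 j).support, zw j + d₁ ≤ Finsupp.weight zw m := by
    intro j m hm
    rw [hv0d] at hm
    rw [hzw0 j (hmovedZ j 1 (MvPolynomial.ne_zero_iff.mpr ⟨m, mem_support_iff.mp hm⟩)), zero_add]
    exact hd₁ j m hm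
  have hv1 : ∀ j, ∀ m ∈ (v 1 j).support, zw j + dstar ≤ Finsupp.weight zw m := by
    intro j m hm
    rw [hv1d] at hm
    rw [hzw0 j (hmovedZ j p (MvPolynomial.ne_zero_iff.mpr ⟨m, mem_support_iff.mp hm⟩)), zero_add]
    exact hdstar j m hm
  have hvZ : ∀ j, ∀ i ∈ (v 1 j).vars, 0 < zw i := fun j i hi => (hzwpos i).mpr (hrigid j p i (by rwa [hv1d] at hi))
  -- `(E_p)`: `∂_{θ_γ} Ḡ = 0` for every coefficient vector `θ_γ` of the leading blocks
  have hEp : ∀ γ : ι →₀ ℕ, InvariantDirection.dirDeriv (fun j => coeff γ (weightedHomogeneousComponent zw (zw j + dstar) (v 1 j)))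
      (weightedHomogeneousComponent zw 0 G) = 0 := fun γ =>
    RZUnpin.dirDeriv_weightedHomogeneousComponent_zero_eq_zero zw _ G fun m hm =>
      RZFirstOrder.coeff_sum_leading_mul_pderiv_eq_zero zw hp0 hstarN v hv0 hv1 hvZ (AdditiveShift.shiftHom P) hC hX hΦ γ m hm
  -- `Ḡ` and the class `C*` of `j₀`
  have hj₀Z : j₀ ∉ Z := hmovedZ j₀ p (MvPolynomial.ne_zero_iff.mpr ⟨γ₀, mem_support_iff.mp hγ₀⟩)
  have hzwj₀ : zw j₀ = 0 := hzw0 j₀ hj₀Z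
  have hGbar : IsWeightedHomogeneous w (weightedHomogeneousComponent zw 0 G) μ :=
    RZToolkit.isWeightedHomogeneous_weightedHomogeneousComponent hG 0
  have hres : ∀ γ : ι →₀ ℕ, InvariantDirection.dirDeriv
      (fun j => if w j = w j₀ then coeff γ (weightedHomogeneousComponent zw (zw j + dstar) (v 1 j)) else 0)
      (weightedHomogeneousComponent zw 0 G) = 0 := fun γ => RZToolkit.dirDeriv_restrict_eq_zero hGbar (hEp γ) (w j₀)
  -- `H`-heavy = at least as heavy as `C*`; `F := killLight_H Ḡ = killLight_H G`
  have hHZ : ∀ i, w j₀ ≤ w i → zw i = 0 := fun i hi => hzw0 i fun hiZ => absurd hi (not_le.mpr (hZlt i hiZ j₀ hj₀Z))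
  have hFG : killLight (fun i => w j₀ ≤ w i) (weightedHomogeneousComponent zw 0 G) = killLight (fun i => w j₀ ≤ w i) G :=
    LemmaL.killLight_weightedHomogeneousComponent_zero (fun i => w j₀ ≤ w i) zw hHZ G
  have hF : IsWeightedHomogeneous w (killLight (fun i => w j₀ ≤ w i) (weightedHomogeneousComponent zw 0 G)) μ :=
    RZToolkit.isWeightedHomogeneous_killLight (fun i => w j₀ ≤ w i) hGbar
  have hFu : ∀ i ∈ (killLight (fun i => w j₀ ≤ w i) (weightedHomogeneousComponent zw 0 G)).vars, w j₀ ≤ w i := fun i hi =>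
    RZToolkit.of_mem_vars_killLight (fun i => w j₀ ≤ w i) hi
  have hresF : ∀ γ : ι →₀ ℕ, InvariantDirection.dirDeriv
      (fun j => if w j = w j₀ then coeff γ (weightedHomogeneousComponent zw (zw j + dstar) (v 1 j)) else 0)
      (killLight (fun i => w j₀ ≤ w i) (weightedHomogeneousComponent zw 0 G)) = 0 := by
    intro γ
    rw [RZUnpin.dirDeriv_killLight (fun i => w j₀ ≤ w i) _ (fun j hj => if_neg fun h : w j = w j₀ => hj h.symm.le), hres γ,
      map_zero]
  have hS : ∀ i ∈ (Finset.univ.filter fun i => w i = w j₀), w i = w j₀ := fun i hi => (Finset.mem_filter.mp hi).2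
  have hj₀S : j₀ ∈ (Finset.univ.filter fun i => w i = w j₀) := Finset.mem_filter.mpr ⟨Finset.mem_univ _, rfl⟩
  have hPj₀ : P j₀ ≠ 0 := fun h => (mem_support_iff.mp hγ₀) (by rw [h, Polynomial.coeff_zero, coeff_zero])
  have hPinF : InvariantDirection.ClassPinned (Finset.univ.filter fun i => w i = w j₀)
      (killLight (fun i => w j₀ ≤ w i) (weightedHomogeneousComponent zw 0 G)) j₀ := by
    rw [hFG]; exact hPin j₀ hPj₀
  -- the leading coefficient vector `θ_{γ₀}` is nonzero at `j₀`
  have hθj₀ : coeff γ₀ (weightedHomogeneousComponent zw (zw j₀ + dstar) (v 1 j₀)) ≠ 0 := by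
    rw [coeff_weightedHomogeneousComponent, if_pos (by rw [hzwj₀, zero_add, hγ₀w]), hv1d]
    exact mem_support_iff.mp hγ₀
  rcases hclass j₀ (by rw [← hv1d]; exact fun h => hθj₀ (by rw [h, map_zero, coeff_zero])) with hf | ⟨hpu, hμ⟩
  swap
  · -- case `C*` an `I`-class: no pin is possible
    refine RZUnpin.not_classPinned_of_dirDeriv_eq_zero p hw hpu hμ hF hFu hS ?_ (fun j hj => if_neg fun h => hj
      (Finset.mem_filter.mpr ⟨Finset.mem_univ _, h⟩)) (hresF γ₀) hj₀S hPinF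
    intro h
    have := congrFun h j₀
    rw [Pi.zero_apply, if_pos rfl] at this
    exact hθj₀ this
  · -- case `C* = f`: `P_p = θ ⊗ α` on the class (Frobenius splitting), change of basis `e_{j₀} := θ`, and `(E_{p²})`
    have hSμ : ∀ i ∈ (Finset.univ.filter fun i => w i = w j₀), (p : ℚ) * w i = μ := fun i hi => by rw [hS i hi, hf]
    obtain ⟨θ, α, hθS, hDθ, hrank⟩ := RZUnpin.exists_rank_one_of_forall_dirDeriv_eq_zero p hperf hw hF hSμ hj₀S hPinF
      (fun j => if w j = w j₀ then weightedHomogeneousComponent zw (zw j + dstar) (v 1 j) else 0)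
      (fun j hj => if_neg fun h => hj (Finset.mem_filter.mpr ⟨Finset.mem_univ _, h⟩)) (fun γ => by
        have e : (fun j => coeff γ (if w j = w j₀ then weightedHomogeneousComponent zw (zw j + dstar) (v 1 j) else 0))
            = fun j => if w j = w j₀ then coeff γ (weightedHomogeneousComponent zw (zw j + dstar) (v 1 j)) else 0 := by
          funext j
          split_ifs with h
          · rfl
          · exact coeff_zero γ
        rw [e]
        exact hresF γ)
    -- `θ_{j₀} ≠ 0`, `α ≠ 0`, `θ ≠ 0`
    have hlead₀ : weightedHomogeneousComponent zw (zw j₀ + dstar) (v 1 j₀) = θ j₀ • α := by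
      have h := hrank j₀
      rwa [if_pos rfl] at h
    have hθα : θ j₀ ≠ 0 ∧ α ≠ 0 := by
      have hne : θ j₀ • α ≠ 0 := by
        rw [← hlead₀]
        exact fun h => hθj₀ (by rw [h, coeff_zero])
      exact ⟨fun h => hne (by rw [h, zero_smul]), fun h => hne (by rw [h, smul_zero])⟩
    have hθ0 : θ ≠ 0 := fun h => hθα.1 (by rw [h, Pi.zero_apply])
    -- `α = (θ j₀)⁻¹ • P^{lead}_{j₀}`: a `Z`-form, `zw`-homogeneous of weight `d*`
    have hαeq : α = (θ j₀)⁻¹ • weightedHomogeneousComponent zw (zw j₀ + dstar) (v 1 j₀) := by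
      rw [hlead₀, smul_smul, inv_mul_cancel₀ hθα.1, one_smul]
    have hαcoeff : ∀ m, coeff m α ≠ 0 → coeff m (v 1 j₀) ≠ 0 ∧ Finsupp.weight zw m = dstar := by
      intro m hm
      rw [hαeq, coeff_smul, coeff_weightedHomogeneousComponent, smul_eq_mul] at hm
      split_ifs at hm with hwt
      · exact ⟨fun h => hm (by rw [h, mul_zero]), by rwa [hzwj₀, zero_add] at hwt⟩
      · exact absurd (mul_zero _) hm
    have hαZ : ∀ i ∈ α.vars, i ∈ Z := by
      intro i hi
      obtain ⟨m, hm, him⟩ := (mem_vars_iff_mem_support i).mp hi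
      refine hrigid j₀ p i ((mem_vars_iff_mem_support i).mpr ⟨m, ?_, him⟩)
      rw [← hv1d]
      exact mem_support_iff.mpr (hαcoeff m (mem_support_iff.mp hm)).1
    have hα : IsWeightedHomogeneous zw α dstar := by
      intro m hm
      exact (hαcoeff m hm).2
    -- every order-`p` block lies on the class `C*` and equals its leading component: `P_p = θ ⊗ α`
    have hv1rank : ∀ j, v 1 j = θ j • α := by
      intro j
      by_cases hj0 : v 1 j = 0
      · have h := hrank j
        rw [hj0, map_zero, ite_self] at h
        rw [hj0]
        exact h
      · obtain ⟨m, hm⟩ := MvPolynomial.ne_zero_iff.mp hj0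
        have hmsupp : m ∈ ((P j).coeff p).support := by
          rw [← hv1d]
          exact mem_support_iff.mpr hm
        have hPjp : (P j).coeff p ≠ 0 := by
          rw [← hv1d]
          exact hj0
        -- the slot `j` has the weight of `j₀`: `d*` minimal gives `w j₀ ≤ w j`, the `f`/`I` dichotomy gives `w j ≤ w j₀`
        have hwj : w j = w j₀ := by
          have h1 : w j₀ - p • ρ₁ ≤ w j - p • ρ₁ := by
            have h : (dstar : ℚ) ≤ (Finsupp.weight zw m : ℚ) := by exact_mod_cast hdstar j m hmsupp
            rw [← hγ₀w, hzdeg j₀ p γ₀ hγ₀, hzdeg j p m hmsupp] at h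
            exact le_of_mul_le_mul_left h hN
          have h2 : (p : ℚ) * w j ≤ μ := by
            rcases hclass j hPjp with h | ⟨h, -⟩
            · exact h.le
            · exact h.le
          have hp' : (0 : ℚ) < p := by exact_mod_cast hp_pos
          rw [← hf] at h2
          have h3 : w j ≤ w j₀ := le_of_mul_le_mul_left h2 hp'
          linarith
        -- all monomials of the block have `Z`-degree `d*`
        have hjZ : j ∉ Z := hmovedZ j p hPjp
        have hhom : IsWeightedHomogeneous zw (v 1 j) (zw j + dstar) := by
          intro m' hm'
          have hm's : m' ∈ ((P j).coeff p).support := by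
            rw [← hv1d]
            exact mem_support_iff.mpr hm'
          rw [hzw0 j hjZ, zero_add]
          have e := hzdeg j p m' hm's
          rw [hwj, ← hzdeg j₀ p γ₀ hγ₀, hγ₀w] at e
          exact_mod_cast e
        have h := hrank j
        rwa [if_pos hwj, hhom.weightedHomogeneousComponent_same] at h
    -- the change of basis `e_{j₀} := θ` on the class `C*`
    obtain ⟨A, A', hA, hA', hcl, hcol⟩ := InvariantDirection.exists_classLinear_col_eq θ hθ0 hθS hj₀S
    have hcl' : InvariantDirection.IsClassLinear (Finset.univ.filter fun i => w i = w j₀) A' := hcl.of_inverse hA hA'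
    have hSZ : ∀ j ∈ (Finset.univ.filter fun i => w i = w j₀), j ∉ Z := fun j hj hjZ =>
      absurd (hS j hj) (ne_of_lt (hZlt j hjZ j₀ hj₀Z))
    have hzwS : ∀ j ∈ (Finset.univ.filter fun i => w i = w j₀), ∀ j' ∈ (Finset.univ.filter fun i => w i = w j₀),
        zw j = zw j' := fun j hj j' hj' => by rw [hzw0 j (hSZ j hj), hzw0 j' (hSZ j' hj')]
    have hwS : ∀ j ∈ (Finset.univ.filter fun i => w i = w j₀), ∀ j' ∈ (Finset.univ.filter fun i => w i = w j₀),
        w j = w j' := fun j hj j' hj' => (hS j hj).trans (hS j' hj').symm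
    have hHS : ∀ j ∈ (Finset.univ.filter fun i => w i = w j₀), w j₀ ≤ w j := fun j hj => (hS j hj).symm.le
    -- the transported isotropy datum
    have hC' := RZTransport.conj_C_C A A' (AdditiveShift.shiftHom P) hC
    have hX' := RZTransport.conj_C_X A A' hA' (![1, p] : Fin 2 → ℕ) v (AdditiveShift.shiftHom P) hC hX
    have hΦ' := RZTransport.conj_C_linSubst A A' hA (AdditiveShift.shiftHom P) hΦ
    have hαA : InvariantDirection.linSubst (fun j k => A j k) α = α :=
      RZTransport.linSubst_eq_self_of_forall_notMem hcl fun i hi hiS => hSZ i hiS (hαZ i hi)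
    have hvi' : ∀ j, (∑ l, C (A' j l) * InvariantDirection.linSubst (fun j k => A j k) (v 1 l)) = if j = j₀ then α else 0 :=
      RZTransport.column_eq_ite_of_rank_one A A' hA' hcol hαA hv1rank
    have hGw' : IsWeightedHomogeneous w (InvariantDirection.linSubst (fun j k => A j k) G) μ :=
      hcl.isWeightedHomogeneous_linSubst hwS hG
    obtain ⟨hG'eq, hR'⟩ := RZTransport.eq_X_pow_mul_C_add hw hGw' hp_pos hf
    -- the pin coefficient `c = [X_{j₀}^p] (G∘A) ≠ 0`
    have hc : coeff (Finsupp.single j₀ p) (InvariantDirection.linSubst (fun j k => A j k) G) ≠ 0 := by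
      have hmem : j₀ ∈ (InvariantDirection.linSubst (fun j k => A j k)
          (killLight (fun i => w j₀ ≤ w i) (weightedHomogeneousComponent zw 0 G))).vars := hPinF A A' hA hA' hcl
      have hD' : pderiv j₀ (InvariantDirection.linSubst (fun j k => A j k)
          (killLight (fun i => w j₀ ≤ w i) (weightedHomogeneousComponent zw 0 G))) = 0 := by
        rw [InvariantDirection.pderiv_linSubst, show (fun j => A j j₀) = θ from funext hcol, hDθ, map_zero]
      have h := RZToolkit.coeff_single_ne_zero_of_pderiv_eq_zero p hw (hcl.isWeightedHomogeneous_linSubst hwS hF) hf hmem hD'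
      rwa [← RZToolkit.killLight_linSubst (fun i => w j₀ ≤ w i) hcl hHS,
        ← RZTransport.weightedHomogeneousComponent_linSubst hcl hzwS G 0,
        RZToolkit.coeff_single_killLight_weightedHomogeneousComponent (fun i => w j₀ ≤ w i) le_rfl hzwj₀] at h
    -- `(E_{p²})`: `c α^p = 0`, so `α = 0` — contradiction
    refine hθα.2 (RZEndgame.eq_zero_of_isotropy zw hp0 hstarN
      (fun t j => ∑ l, C (A' j l) * InvariantDirection.linSubst (fun j k => A j k) (v t l))
      (fun j m hm => RZTransport.le_weight_of_mem_support_column hcl hcl' hzwS (v 0) hv0 j hm)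
      (fun j m hm => RZTransport.le_weight_of_mem_support_column hcl hcl' hzwS (v 1) hv1 j hm)
      hvi' hα hc hG'eq hR' (RZTransport.conj A A' (AdditiveShift.shiftHom P)) hC' hX' hΦ')

end TheoremRZ

end Literature.AlgebraicGeometry.Resolution.WeightedBlowup
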